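import Mathlib
import Summits.ResolutionOfSingularities.ResolutionOfSingularities.Theorems.HomologicalConductorSurfaceTerminationReductionFourFacts
import HarnessLib

/-!
# Route `HomologicalConductor`: the TWO open cruxes `StrictDrop` (stmt-16485) and `NoZenoR` (stmt-19943) TOGETHER, and their exact
# residual modulo four prints — valuative termination ⟺ (D-s) ∧ (TOP′)

Route `ResolutionOfSingularities/HomologicalConductor` (cell decomp-res, hand leafhand-res-homologicalconduct-3 g1).
OURS: AI-written, weaker than expert review; nothing here is a statement of the manuscript under review (Hironaka 2017).
SUPPORT level, counted 0.  Def-free, no new named facts.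

Write (UT) for «valuative termination»: every admissible datum `(p, k, K, O, A)` has a regular stage of its canonical
normalised `ca`-tower — the antecedent of the crux `Globalisation` and the conclusion of `NoZenoR`.

* `forall_terminates_iff_strictDrop_and_noZenoR` (fact-free): **(UT) ⟺ StrictDrop ∧ NoZenoR** — `→` by the endpoint calibration
  `HighDimDoor.strictDrop_of_forall_terminates` and triviality; `←` because `PersistenceRadical` is a tree theorem.  So the
  route's two open cruxes are, jointly, exactly (UT).
* `forall_terminates_iff_primeDivisorCase_and_topDim'_of_facts4`: **modulo the FOUR prints {CJS 2020 Thm 1.2, Lipman (1.2), (4.1),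
  (12.1)(ii)}, (UT) ⟺ (D-s) ∧ (TOP′)** — (D-s) = `PrimeDivisorSurfaceTermination` «the ca-tower of a two-dimensional affine model
  terminates along every PRIME DIVISOR», (TOP′) = «every admissible datum with `dim A ≥ 3` whose tower keeps the top dimension
  terminates».  `←` is hand-3's door over the four-fact kill-test reduction; `→` is restriction.
* `cruxes_iff_primeDivisorCase_and_topDim'_of_facts4`: hence **StrictDrop ∧ NoZenoR ⟺ (D-s) ∧ (TOP′)** modulo the four prints —
  the exact joint residual of the route's open cruxes (the assembly `closes` needs in addition only `Globalisation`, stmt-16486).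

No crux, kill test or summit statement is proved; resolution of singularities in positive characteristic is NOT proved.
-/

-- single-problem summit: the doubled namespace component `ResolutionOfSingularities` is forced
set_option linter.dupNamespace false

noncomputable section

open Summit.ResolutionOfSingularities.ResolutionOfSingularities.Theses.HomologicalConductor
open Summit.ResolutionOfSingularities.ResolutionOfSingularities.Theorems
open Summit.ResolutionOfSingularities.ResolutionOfSingularities.Theorems.NoZeno.Birth
open Summit.ResolutionOfSingularities.ResolutionOfSingularities.Theorems.NoZeno

namespace Summit.ResolutionOfSingularities.ResolutionOfSingularities.Theorems.SurfaceTermination.Reduction.FourFacts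

/-- **(UT) ⟺ StrictDrop ∧ NoZenoR** (fact-free): valuative termination of every canonical tower is exactly the conjunction of the
route's two open cruxes (`PersistenceRadical`, the third hypothesis of `NoZenoR`, is the tree theorem `persistenceRadical_proof`).
[this work; composition of tree results] -/
theorem forall_terminates_iff_strictDrop_and_noZenoR :
    (∀ p : ℕ, p.Prime → ∀ (k K : Type) [Field k] [CharP k p] [Field K] [Algebra k K]
      (O : ValuationSubring K) (A : Subalgebra k K), (∀ c : k, algebraMap k K c ∈ O) → A.FG →
      IsFractionRing ↥A K → A.toSubring ≤ O.toSubring → ∃ m : ℕ, IsRegularLocalRing ↥(tower O A m)) ↔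
    (StrictDrop ∧ NoZenoR) := by
  constructor
  · intro hT
    exact ⟨HighDimDoor.strictDrop_of_forall_terminates hT,
      DiscreteDominator.noZenoR_iff.mpr fun _ _ p hp k K _ _ _ _ O A hk hA hfr hAO => hT p hp k K O A hk hA hfr hAO⟩
  · rintro ⟨hD, hN⟩ p hp k K _ _ _ _ O A hk hA hfr hAO
    exact DiscreteDominator.noZenoR_iff.mp hN Theorems.persistenceRadical_proof hD p hp k K O A hk hA hfr hAO

/-- **Modulo FOUR prints, (UT) ⟺ (D-s) ∧ (TOP′)**: valuative termination of every canonical tower is equivalent to its two special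
cases «along prime divisors of surfaces» and «top-dimensional towers of dimension `≥ 3`» — `←` by the four-fact kill-test reduction
(`surfaceTermination_of_primeDivisorCase_of_facts4`) and hand-3's door `HighDimDoor.forall_terminates_of_surfaceTermination_of_topDim'`.
[cite: ZariskiSamuel1960, Ch. VI §14, Thm. 31] [cite: Lipman1969, (1.2), (4.1), (12.1)(ii)] [cite: CossartJannsenSaito2020, Thm. 1.2] -/
theorem forall_terminates_iff_primeDivisorCase_and_topDim'_of_facts4
    (hF : (Literature.AlgebraicGeometry.Resolution.CossartJannsenSaito2020General.{0} ∧
      Literature.AlgebraicGeometry.Resolution.Lipman1969_1_2.{0} ∧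
      Literature.AlgebraicGeometry.Resolution.Lipman1969_4_1.{0} ∧
      Literature.AlgebraicGeometry.Resolution.Lipman1969_12_1_ii.{0})) :
    (∀ p : ℕ, p.Prime → ∀ (k K : Type) [Field k] [CharP k p] [Field K] [Algebra k K]
      (O : ValuationSubring K) (A : Subalgebra k K), (∀ c : k, algebraMap k K c ∈ O) → A.FG →
      IsFractionRing ↥A K → A.toSubring ≤ O.toSubring → ∃ m : ℕ, IsRegularLocalRing ↥(tower O A m)) ↔
    (PrimeDivisorSurfaceTermination ∧
      ∀ p : ℕ, p.Prime → ∀ (k K : Type) [Field k] [CharP k p] [Field K] [Algebra k K]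
        (O : ValuationSubring K) (A : Subalgebra k K), (∀ c : k, algebraMap k K c ∈ O) → A.FG →
        IsFractionRing ↥A K → A.toSubring ≤ O.toSubring → ¬ ringKrullDim ↥A ≤ 2 →
        (∀ n : ℕ, ringKrullDim ↥(tower O A n) = ringKrullDim ↥A) → ∃ m : ℕ, IsRegularLocalRing ↥(tower O A m)) := by
  constructor
  · intro hT
    refine ⟨fun p hp k K _ _ _ _ O A hk hA hfr hAO _ _ _ _ => hT p hp k K O A hk hA hfr hAO,
      fun p hp k K _ _ _ _ O A hk hA hfr hAO _ _ => hT p hp k K O A hk hA hfr hAO⟩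
  · rintro ⟨hDs, hTop⟩ p hp k K _ _ _ _ O A hk hA hfr hAO
    exact HighDimDoor.forall_terminates_of_surfaceTermination_of_topDim'
      (surfaceTermination_of_primeDivisorCase_of_facts4 hF hDs) hTop p hp k K O A hk hA hfr hAO

/-- **THE EXACT JOINT RESIDUAL OF THE ROUTE'S OPEN CRUXES modulo four prints: `StrictDrop ∧ NoZenoR ⟺ (D-s) ∧ (TOP′)`.**
[cite: ZariskiSamuel1960, Ch. VI §14, Thm. 31] [cite: Lipman1969, (1.2), (4.1), (12.1)(ii)] [cite: CossartJannsenSaito2020, Thm. 1.2] -/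
theorem cruxes_iff_primeDivisorCase_and_topDim'_of_facts4
    (hF : (Literature.AlgebraicGeometry.Resolution.CossartJannsenSaito2020General.{0} ∧
      Literature.AlgebraicGeometry.Resolution.Lipman1969_1_2.{0} ∧
      Literature.AlgebraicGeometry.Resolution.Lipman1969_4_1.{0} ∧
      Literature.AlgebraicGeometry.Resolution.Lipman1969_12_1_ii.{0})) :
    (StrictDrop ∧ NoZenoR) ↔
    (PrimeDivisorSurfaceTermination ∧
      ∀ p : ℕ, p.Prime → ∀ (k K : Type) [Field k] [CharP k p] [Field K] [Algebra k K]
        (O : ValuationSubring K) (A : Subalgebra k K), (∀ c : k, algebraMap k K c ∈ O) → A.FG →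
        IsFractionRing ↥A K → A.toSubring ≤ O.toSubring → ¬ ringKrullDim ↥A ≤ 2 →
        (∀ n : ℕ, ringKrullDim ↥(tower O A n) = ringKrullDim ↥A) → ∃ m : ℕ, IsRegularLocalRing ↥(tower O A m)) :=
  forall_terminates_iff_strictDrop_and_noZenoR.symm.trans (forall_terminates_iff_primeDivisorCase_and_topDim'_of_facts4 hF)

end Summit.ResolutionOfSingularities.ResolutionOfSingularities.Theorems.SurfaceTermination.Reduction.FourFacts

end
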